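import Summits.CriticalPhenomena.PercolationContinuityZ3.Theorems.PercNearOneGluingNoHeavyRsw3InvasionFreshCluster
import HarnessLib

/-!
# RSW3 lane (P2, gen 28): INVASION PERCOLATION XXIII — THE SWALLOWED CLUSTERS ARE DOMINATED BY FREE ONES:
# `exp(t·min(L, |P_n|))·Φ^{−(M_n(y)+1)}` is a supermartingale, and `μ{M_N(y) ≤ k} ≤ Φ^{k+1} e^{−t(N+1)}` on every graph

builds on p205010 (kernel theorem, internal audit signed; external expert review pending) — NOT used in this file.

Cell `prim-rsw3`, prover seat `prim-rsw3-p2` (gen 28), memo `run/shared/lean/prim/rsw3/P2-RSWLITE.md` §35.  Support file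
(`--supports stmt-CriticalPhenomena-4575`); no definitions, no named facts, no sorries.  Notation as in files XXI–XXII: `P_n = ⋃_{v ∈ I_n} C_y(v)` the
pond closure, `M_n(y) = badCount … y n` the number of outlets before time `n`, `T_L(s) = min(s, L)` the truncated volume (`((min s L).toNat : ℝ)`),
`C^{ext,S}_y(w)` the cluster of `w` in the level-`y` configuration of `G.deleteEdges E_S`.

Chayes–Chayes–Newman's Lemma 3.4: below `π_c` the clusters successively swallowed by the invasion have uniformly exponential tails, "since the
(k+1)-st cluster is discovered in the complement of the checked bonds".  Kernel form, without stopping times: for `t ≥ 0`, a truncation level `L`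
and any majorant `Φ ≥ 1 + Σ_{m=1}^{L} (e^{tm} − e^{t(m−1)})·q_m` of the truncated exponential moment of a free cluster (`q_m ≥ μ{m ≤ |C_y(v)|}` for all
vertices `v`), the process
  `Z_n = exp(t·T_L(|P_n|)) · Φ^{−(M_n(y)+1)}`
satisfies `E[Z_{n+1}] ≤ E[Z_n] ≤ … ≤ E[Z_0] ≤ 1`: a non-outlet step changes nothing (file XXI: `P_{n+1} = P_n`); an outlet step multiplies `Z` by at
most `Φ^{−1}·exp(t·T_L|C^{ext}|)` where the exterior cluster `C^{ext}` of the new vertex is independent of the past piece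
`{I_n = S, w_n = w, outlet, M_n = c}` and has truncated exponential moment `≤ Φ` (file XXII, the freshness step).  Since `|P_N| ≥ N + 1`, Markov's
inequality with `L = N + 1` gives **`μ{M_N(y) ≤ k} ≤ Φ^{k+1}·e^{−t(N+1)}`**: few outlets by time `N` force the first `k + 1` swallowed clusters to have
total volume `≥ N + 1`.

* **`integral_pondSupermartingale_succ_le`** — `E[Z_{n+1}] ≤ E[Z_n]`; **`integral_pondSupermartingale_le_one`** — `E[Z_n] ≤ 1`.
* **`labelMeasure_real_badCount_le_le`** — `μ{M_N(y) ≤ k} ≤ Φ^{k+1}·exp(−t(N+1))` (infinite connected locally finite graph, countable vertex set,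
  every level `y`, every `t ≥ 0`).
File XXIV (`…Rsw3InvasionOutletDensity`) feeds in the subcritical volume tail of `ℤ^d` (Hutchcroft) and Borel–Cantelli.

References: J. T. Chayes, L. Chayes, C. M. Newman, Comm. Math. Phys. 101 (1985) 383–407, Lemma 3.4 (and (3.18)–(3.21)), Thm 3.3
[ChayesChayesNewman1985].
-/

noncomputable section

namespace Summit.CriticalPhenomena.PercolationContinuityZ3.Theorems.Rsw3

open Finset MeasureTheory Filter Topology Literature.Probability.Percolation Literature.Probability.Percolation.Invasion
open scoped ENNReal

section General

variable {V : Type*} [DecidableEq V] {G : SimpleGraph V} [G.LocallyFinite] [Countable V]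

/-! ## §3 The supermartingale `Z_n = exp(t·T_L(|P_n|))·Φ^{−(M_n+1)}` -/

variable [Infinite V]

/-- **`E[Z_{n+1}] ≤ E[Z_n]`** for `Z_n = exp(t·T_L(|P_n|))·Φ^{−(M_n(y)+1)}` on an infinite connected locally finite graph with countable vertex set, every
label level `y`, `t ≥ 0`, truncation `L`, tail majorants `q` and `Φ ≥ max(1, 1 + Σ_{m=1}^{L}(e^{tm} − e^{t(m−1)}) q_m)`.  Non-outlet steps leave `Z`
unchanged (file XXI: `P_{n+1} = P_n`); on the outlet piece `{I_n = S, w_n = w, x_n > y, M_n = c}` one has `Z_n = e^{t T_L(n+1)}Φ^{−(c+1)}` and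
`Z_{n+1} ≤ Z_n · Φ^{−1} · exp(t·T_L|C^{ext,S}_y(w)|)`, whose integral over the piece is `≤ Z_n·μ(piece)` by the freshness step.
[cite: ChayesChayesNewman1985, Lemma 3.4] -/
theorem integral_pondSupermartingale_succ_le (hG : G.Preconnected) (o : V) (y : ℝ) {t : ℝ} (ht : 0 ≤ t) (L : ℕ) (q : ℕ → ℝ)
    (hq : ∀ (v : V) (m : ℕ), 1 ≤ m → m ≤ L →
      (labelMeasure V).real {U : Sym2 V → ℝ | (m : ℕ∞) ≤ (openCluster (configOfLabels y U G) v).encard} ≤ q m)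
    {Φ : ℝ} (hΦ1 : 1 ≤ Φ) (hΦ : 1 + ∑ m ∈ Icc 1 L, (Real.exp (t * m) - Real.exp (t * (m - 1))) * q m ≤ Φ) (n : ℕ) :
    ∫ U, Real.exp (t * ((min (⋃ v ∈ invasion G U o (n + 1), openCluster (configOfLabels y U G) v).encard (L : ℕ∞)).toNat : ℝ))
          * Φ⁻¹ ^ (badCount G U o y (n + 1) + 1) ∂(labelMeasure V)
      ≤ ∫ U, Real.exp (t * ((min (⋃ v ∈ invasion G U o n, openCluster (configOfLabels y U G) v).encard (L : ℕ∞)).toNat : ℝ))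
          * Φ⁻¹ ^ (badCount G U o y n + 1) ∂(labelMeasure V) := by
  haveI : IsProbabilityMeasure (labelMeasure V) := isProbabilityMeasure_labelMeasure _
  have hΦ0 : 0 < Φ := lt_of_lt_of_le one_pos hΦ1
  have hΦi0 : 0 ≤ Φ⁻¹ := inv_nonneg.2 hΦ0.le
  have hΦi1 : Φ⁻¹ ≤ 1 := inv_le_one_of_one_le₀ hΦ1
  obtain ⟨F, hF⟩ := exists_finset_forall_invasion_mem (G := G) o n
  -- abbreviations
  set T : ℕ∞ → ℝ := fun s => ((min s (L : ℕ∞)).toNat : ℝ) with hT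
  set P : ℕ → (Sym2 V → ℝ) → Set V := fun k U => ⋃ v ∈ invasion G U o k, openCluster (configOfLabels y U G) v with hP
  set Z : ℕ → (Sym2 V → ℝ) → ℝ := fun k U => Real.exp (t * T (P k U).encard) * Φ⁻¹ ^ (badCount G U o y k + 1) with hZ
  set Y : Finset V → V → (Sym2 V → ℝ) → ℝ := fun S w U =>
    Real.exp (t * T (openCluster (configOfLabels y U (G.deleteEdges {e | ∃ x ∈ S, x ∈ e})) w).encard) with hY
  set A : Finset V → V → ℕ → Set (Sym2 V → ℝ) := fun S w c =>
    {U | invasion G U o n = S ∧ (∃ z, newDart G U S = some (z, w)) ∧ y < acceptedLabel G U o n ∧ badCount G U o y n = c} with hA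
  set κ : ℕ → ℝ := fun c => Real.exp (t * T ((n + 1 : ℕ) : ℕ∞)) * Φ⁻¹ ^ (c + 1) with hκ
  set N : Set (Sym2 V → ℝ) := {U | ¬ y < acceptedLabel G U o n} with hN
  show ∫ U, Z (n + 1) U ∂(labelMeasure V) ≤ ∫ U, Z n U ∂(labelMeasure V)
  -- basic bounds
  have hT0 : ∀ s, 0 ≤ T s := fun s => by positivity
  have hZ0 : ∀ k U, 0 ≤ Z k U := fun k U => mul_nonneg (Real.exp_nonneg _) (pow_nonneg hΦi0 _)
  have hZle : ∀ k U, Z k U ≤ Real.exp (t * L) := fun k U =>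
    calc Z k U ≤ Real.exp (t * L) * 1 :=
          mul_le_mul (exp_mul_truncVol_le ht L _) (pow_le_one₀ hΦi0 hΦi1) (pow_nonneg hΦi0 _) (Real.exp_nonneg _)
      _ = Real.exp (t * L) := mul_one _
  have hY0 : ∀ S w U, 0 ≤ Y S w U := fun S w U => Real.exp_nonneg _
  have hYle : ∀ S w U, Y S w U ≤ Real.exp (t * L) := fun S w U => exp_mul_truncVol_le ht L _
  have hκ0 : ∀ c, 0 ≤ κ c := fun c => mul_nonneg (Real.exp_nonneg _) (pow_nonneg hΦi0 _)
  -- measurability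
  have hZm : ∀ k, Measurable (Z k) := fun k =>
    ((measurable_truncVol (fun m => measurableSet_le_encard_pondClosure (G := G) o y k m) L).const_mul t).exp.mul
      ((measurable_from_nat (f := fun c : ℕ => Φ⁻¹ ^ (c + 1))).comp (measurable_badCount o y k))
  have hYm : ∀ S w, Measurable (Y S w) := fun S w =>
    ((measurable_truncVol (fun m => measurableSet_le_encard_exteriorCluster (G := G) y S w m) L).const_mul t).exp
  have hAm : ∀ S w c, MeasurableSet (A S w c) := fun S w c => measurableSet_outletPiece o n S w y c
  have hNm : MeasurableSet N := (measurableSet_setOf.2 (measurable_lt_acceptedLabel (G := G) o y n)).compl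
  -- integrability of the pieces (bounded measurable functions on a probability space)
  have hint_bdd : ∀ {f : (Sym2 V → ℝ) → ℝ}, Measurable f → (∀ U, |f U| ≤ Real.exp (t * L) * Real.exp (t * L)) →
      Integrable f (labelMeasure V) := fun hf hb =>
    (memLp_top_of_bound hf.aestronglyMeasurable (Real.exp (t * L) * Real.exp (t * L))
      (Eventually.of_forall fun U => by rw [Real.norm_eq_abs]; exact hb U)).integrable le_top
  have h1L : (1 : ℝ) ≤ Real.exp (t * L) := Real.one_le_exp (by positivity)
  have hintZ : ∀ k, Integrable (Z k) (labelMeasure V) := fun k =>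
    hint_bdd (hZm k) fun U => by
      rw [abs_of_nonneg (hZ0 k U)]
      calc Z k U ≤ Real.exp (t * L) * 1 := by rw [mul_one]; exact hZle k U
        _ ≤ _ := by gcongr
  have hintNZ : Integrable (fun U => N.indicator (fun _ => (1 : ℝ)) U * Z n U) (labelMeasure V) := by
    refine hint_bdd ((measurable_const.indicator hNm).mul (hZm n)) fun U => ?_
    rw [abs_mul, abs_of_nonneg (hZ0 n U)]
    have : |N.indicator (fun _ => (1 : ℝ)) U| ≤ 1 := by
      by_cases h : U ∈ N
      · rw [Set.indicator_of_mem h]; simp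
      · rw [Set.indicator_of_notMem h]; simp
    calc _ ≤ 1 * (Real.exp (t * L) * 1) := by rw [mul_one]; exact mul_le_mul this (hZle n U) (hZ0 n U) zero_le_one
      _ ≤ _ := by rw [one_mul]; gcongr
  have hintAY : ∀ S w c, Integrable (fun U => (A S w c).indicator (fun _ => (1 : ℝ)) U * (κ c * Φ⁻¹ * Y S w U))
      (labelMeasure V) := by
    intro S w c
    refine hint_bdd ((measurable_const.indicator (hAm S w c)).mul ((hYm S w).const_mul _)) fun U => ?_
    have hi : |(A S w c).indicator (fun _ => (1 : ℝ)) U| ≤ 1 := by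
      by_cases h : U ∈ A S w c
      · rw [Set.indicator_of_mem h]; simp
      · rw [Set.indicator_of_notMem h]; simp
    have hκle : κ c ≤ Real.exp (t * L) := by
      calc κ c ≤ Real.exp (t * L) * 1 :=
            mul_le_mul (exp_mul_truncVol_le ht L _) (pow_le_one₀ hΦi0 hΦi1) (pow_nonneg hΦi0 _) (Real.exp_nonneg _)
        _ = _ := mul_one _
    rw [abs_mul, abs_of_nonneg (mul_nonneg (mul_nonneg (hκ0 c) hΦi0) (hY0 S w U))]
    calc _ ≤ 1 * (Real.exp (t * L) * 1 * Real.exp (t * L)) :=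
          mul_le_mul hi (by gcongr; exact hYle S w U) (mul_nonneg (mul_nonneg (hκ0 c) hΦi0) (hY0 S w U)) zero_le_one
      _ = _ := by ring
  have hintAκ : ∀ S w c, Integrable (fun U => (A S w c).indicator (fun _ => (1 : ℝ)) U * κ c) (labelMeasure V) :=
    fun S w c => (((integrable_const (1 : ℝ)).indicator (hAm S w c)).mul_const (κ c))
  -- uniqueness of the piece containing a label field
  have hpiece : ∀ U S w c, U ∈ A S w c → ∀ {a : V × V}, newDart G U (invasion G U o n) = some a →
      S = invasion G U o n ∧ w = a.2 ∧ c = badCount G U o y n := by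
    rintro U S w c ⟨hI, ⟨z, hz⟩, _, hc⟩ a ha
    subst hI
    rw [ha] at hz
    cases hz
    exact ⟨rfl, rfl, hc.symm⟩
  -- POINTWISE STEP 1: `Z_{n+1} ≤ 𝟙_N Z_n + Σ_{S,w,c} 𝟙_{A(S,w,c)} κ_c Φ⁻¹ Y_{S,w}`
  have hstep : ∀ U, Z (n + 1) U ≤ N.indicator (fun _ => (1 : ℝ)) U * Z n U
      + ∑ S ∈ F, ∑ w ∈ S.biUnion (fun v => G.neighborFinset v), ∑ c ∈ Finset.range (n + 1),
          (A S w c).indicator (fun _ => (1 : ℝ)) U * (κ c * Φ⁻¹ * Y S w U) := by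
    intro U
    obtain ⟨a, ha⟩ := exists_newDart_eq_some (U := U) (boundaryDarts_invasion_nonempty hG U o n)
    have hsum0 : ∀ S ∈ F, ∀ w ∈ S.biUnion (fun v => G.neighborFinset v), ∀ c ∈ Finset.range (n + 1),
        (S, w, c) ≠ (invasion G U o n, a.2, badCount G U o y n) →
        (A S w c).indicator (fun _ => (1 : ℝ)) U * (κ c * Φ⁻¹ * Y S w U) = 0 := by
      intro S _ w _ c _ hne
      have : U ∉ A S w c := fun h => by
        obtain ⟨h1, h2, h3⟩ := hpiece U S w c h ha
        exact hne (by rw [h1, h2, h3])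
      rw [Set.indicator_of_notMem this, zero_mul]
    have hnonneg : ∀ S w c, 0 ≤ (A S w c).indicator (fun _ => (1 : ℝ)) U * (κ c * Φ⁻¹ * Y S w U) := fun S w c =>
      mul_nonneg (Set.indicator_nonneg (fun _ _ => zero_le_one) _) (mul_nonneg (mul_nonneg (hκ0 c) hΦi0) (hY0 S w U))
    by_cases hout : y < acceptedLabel G U o n
    · -- outlet step
      have hlab : y < U s(a.1, a.2) := by rwa [acceptedLabel_of_eq_some G ha] at hout
      have hS0 : invasion G U o n ∈ F := hF U
      have hw0 : a.2 ∈ (invasion G U o n).biUnion (fun v => G.neighborFinset v) :=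
        Finset.mem_biUnion.2 ⟨a.1, fst_mem_of_newDart ha, (G.mem_neighborFinset _ _).2 (adj_of_newDart ha)⟩
      have hc0 : badCount G U o y n ∈ Finset.range (n + 1) := Finset.mem_range.2 (Nat.lt_succ_of_le (badCount_le n))
      have hUA : U ∈ A (invasion G U o n) a.2 (badCount G U o y n) := ⟨rfl, ⟨a.1, ha⟩, hout, rfl⟩
      -- the triple sum is its single non-zero term
      have hsum : ∑ S ∈ F, ∑ w ∈ S.biUnion (fun v => G.neighborFinset v), ∑ c ∈ Finset.range (n + 1),
          (A S w c).indicator (fun _ => (1 : ℝ)) U * (κ c * Φ⁻¹ * Y S w U)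
          = κ (badCount G U o y n) * Φ⁻¹ * Y (invasion G U o n) a.2 U := by
        rw [Finset.sum_eq_single_of_mem _ hS0 (fun S hS hne => Finset.sum_eq_zero fun w hw => Finset.sum_eq_zero fun c hc =>
              hsum0 S hS w hw c hc (fun h => hne (Prod.mk.inj h).1)),
          Finset.sum_eq_single_of_mem _ hw0 (fun w hw hne => Finset.sum_eq_zero fun c hc =>
              hsum0 _ hS0 w hw c hc (fun h => hne (Prod.mk.inj (Prod.mk.inj h).2).1)),
          Finset.sum_eq_single_of_mem _ hc0 (fun c hc hne =>
              hsum0 _ hS0 _ hw0 c hc (fun h => hne (Prod.mk.inj (Prod.mk.inj h).2).2)),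
          Set.indicator_of_mem hUA, one_mul]
      rw [hsum, Set.indicator_of_notMem (show U ∉ N from fun h => h hout), zero_mul, zero_add]
      -- `Z_{n+1} ≤ κ_c Φ⁻¹ Y`
      have hbc : badCount G U o y (n + 1) = badCount G U o y n + 1 := by rw [badCount_succ, if_pos hout]
      have hvol : T (P (n + 1) U).encard ≤ T ((n + 1 : ℕ) : ℕ∞)
          + T (openCluster (configOfLabels y U (G.deleteEdges {e | ∃ x ∈ invasion G U o n, x ∈ e})) a.2).encard := by
        have h1 := encard_pondClosure_succ_le_of_outlet hG (y := y) ha hout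
        have h2 := toNat_min_mono h1 L
        have h3 := toNat_min_add_le ((n + 1 : ℕ) : ℕ∞)
          (openCluster (configOfLabels y U (G.deleteEdges {e | ∃ x ∈ invasion G U o n, x ∈ e})) a.2).encard L
        simp only [hT]
        exact_mod_cast h2.trans h3
      calc Z (n + 1) U = Real.exp (t * T (P (n + 1) U).encard) * Φ⁻¹ ^ (badCount G U o y n + 1 + 1) := by
            simp only [hZ, hbc]
        _ ≤ Real.exp (t * (T ((n + 1 : ℕ) : ℕ∞)
              + T (openCluster (configOfLabels y U (G.deleteEdges {e | ∃ x ∈ invasion G U o n, x ∈ e})) a.2).encard))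
              * Φ⁻¹ ^ (badCount G U o y n + 1 + 1) := by
            gcongr
        _ = κ (badCount G U o y n) * Φ⁻¹ * Y (invasion G U o n) a.2 U := by
            simp only [hκ, hY, mul_add, Real.exp_add, pow_succ]; ring
    · -- non-outlet step: `Z_{n+1} = Z_n`
      have hlab : U s(a.1, a.2) ≤ y := by rw [acceptedLabel_of_eq_some G ha] at hout; exact not_lt.1 hout
      have hbc : badCount G U o y (n + 1) = badCount G U o y n := by rw [badCount_succ, if_neg hout, add_zero]
      have hPP : P (n + 1) U = P n U := pondClosure_succ_eq_of_not_outlet ha hlab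
      have hZZ : Z (n + 1) U = Z n U := by simp only [hZ, hbc, hPP]
      have hsum : 0 ≤ ∑ S ∈ F, ∑ w ∈ S.biUnion (fun v => G.neighborFinset v), ∑ c ∈ Finset.range (n + 1),
          (A S w c).indicator (fun _ => (1 : ℝ)) U * (κ c * Φ⁻¹ * Y S w U) :=
        Finset.sum_nonneg fun S _ => Finset.sum_nonneg fun w _ => Finset.sum_nonneg fun c _ => hnonneg S w c
      rw [hZZ, Set.indicator_of_mem (show U ∈ N from hout), one_mul]
      linarith
  -- POINTWISE STEP 2: `Z_n = 𝟙_N Z_n + Σ_{S,w,c} 𝟙_{A(S,w,c)} κ_c`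
  have hsplit : ∀ U, Z n U = N.indicator (fun _ => (1 : ℝ)) U * Z n U
      + ∑ S ∈ F, ∑ w ∈ S.biUnion (fun v => G.neighborFinset v), ∑ c ∈ Finset.range (n + 1),
          (A S w c).indicator (fun _ => (1 : ℝ)) U * κ c := by
    intro U
    obtain ⟨a, ha⟩ := exists_newDart_eq_some (U := U) (boundaryDarts_invasion_nonempty hG U o n)
    have hsum0 : ∀ S ∈ F, ∀ w ∈ S.biUnion (fun v => G.neighborFinset v), ∀ c ∈ Finset.range (n + 1),
        (S, w, c) ≠ (invasion G U o n, a.2, badCount G U o y n) →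
        (A S w c).indicator (fun _ => (1 : ℝ)) U * κ c = 0 := by
      intro S _ w _ c _ hne
      have : U ∉ A S w c := fun h => by
        obtain ⟨h1, h2, h3⟩ := hpiece U S w c h ha
        exact hne (by rw [h1, h2, h3])
      rw [Set.indicator_of_notMem this, zero_mul]
    by_cases hout : y < acceptedLabel G U o n
    · have hS0 : invasion G U o n ∈ F := hF U
      have hw0 : a.2 ∈ (invasion G U o n).biUnion (fun v => G.neighborFinset v) :=
        Finset.mem_biUnion.2 ⟨a.1, fst_mem_of_newDart ha, (G.mem_neighborFinset _ _).2 (adj_of_newDart ha)⟩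
      have hc0 : badCount G U o y n ∈ Finset.range (n + 1) := Finset.mem_range.2 (Nat.lt_succ_of_le (badCount_le n))
      have hUA : U ∈ A (invasion G U o n) a.2 (badCount G U o y n) := ⟨rfl, ⟨a.1, ha⟩, hout, rfl⟩
      have hsum : ∑ S ∈ F, ∑ w ∈ S.biUnion (fun v => G.neighborFinset v), ∑ c ∈ Finset.range (n + 1),
          (A S w c).indicator (fun _ => (1 : ℝ)) U * κ c = κ (badCount G U o y n) := by
        rw [Finset.sum_eq_single_of_mem _ hS0 (fun S hS hne => Finset.sum_eq_zero fun w hw => Finset.sum_eq_zero fun c hc =>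
              hsum0 S hS w hw c hc (fun h => hne (Prod.mk.inj h).1)),
          Finset.sum_eq_single_of_mem _ hw0 (fun w hw hne => Finset.sum_eq_zero fun c hc =>
              hsum0 _ hS0 w hw c hc (fun h => hne (Prod.mk.inj (Prod.mk.inj h).2).1)),
          Finset.sum_eq_single_of_mem _ hc0 (fun c hc hne =>
              hsum0 _ hS0 _ hw0 c hc (fun h => hne (Prod.mk.inj (Prod.mk.inj h).2).2)),
          Set.indicator_of_mem hUA, one_mul]
      rw [hsum, Set.indicator_of_notMem (show U ∉ N from fun h => h hout), zero_mul, zero_add]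
      -- at an outlet, `P_n = I_n` has `n + 1` vertices
      have hPn : (P n U).encard = ((n + 1 : ℕ) : ℕ∞) := by
        simp only [hP]
        rw [pondClosure_eq_coe_of_outlet hout, Set.encard_coe_eq_coe_finsetCard, card_invasion hG U o n]
      simp only [hZ, hκ, hPn]
    · have hsum : ∑ S ∈ F, ∑ w ∈ S.biUnion (fun v => G.neighborFinset v), ∑ c ∈ Finset.range (n + 1),
          (A S w c).indicator (fun _ => (1 : ℝ)) U * κ c = 0 :=
        Finset.sum_eq_zero fun S _ => Finset.sum_eq_zero fun w _ => Finset.sum_eq_zero fun c _ => by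
          rw [Set.indicator_of_notMem (fun h : U ∈ A S w c => hout h.2.2.1), zero_mul]
      rw [hsum, Set.indicator_of_mem (show U ∈ N from hout), one_mul, add_zero]
  -- INTEGRATE: each outlet piece contributes at most `κ_c μ(A)` by the freshness step
  have hpieceInt : ∀ S w c, ∫ U, (A S w c).indicator (fun _ => (1 : ℝ)) U * (κ c * Φ⁻¹ * Y S w U) ∂(labelMeasure V)
      ≤ ∫ U, (A S w c).indicator (fun _ => (1 : ℝ)) U * κ c ∂(labelMeasure V) := by
    intro S w c
    have hfresh := integral_indicator_mul_exp_exterior_le (G := G) y ht L q hq S w (hAm S w c)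
      (fun U U' h => outletPiece_iff_of_agree o n S w y c U U' h)
    have hre : (fun U => (A S w c).indicator (fun _ => (1 : ℝ)) U * (κ c * Φ⁻¹ * Y S w U))
        = fun U => (κ c * Φ⁻¹) * ((A S w c).indicator (fun _ => (1 : ℝ)) U * Y S w U) := by
      funext U; ring
    rw [hre, integral_const_mul, integral_mul_const, integral_indicator_const _ (hAm S w c), smul_eq_mul, mul_one]
    calc κ c * Φ⁻¹ * ∫ U, (A S w c).indicator (fun _ => (1 : ℝ)) U * Y S w U ∂(labelMeasure V)
        ≤ κ c * Φ⁻¹ * ((labelMeasure V).real (A S w c) * Φ) := by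
          refine mul_le_mul_of_nonneg_left (hfresh.trans ?_) (mul_nonneg (hκ0 c) hΦi0)
          exact mul_le_mul_of_nonneg_left hΦ measureReal_nonneg
      _ = (labelMeasure V).real (A S w c) * κ c := by field_simp
  -- assemble
  calc ∫ U, Z (n + 1) U ∂(labelMeasure V)
      ≤ ∫ U, (N.indicator (fun _ => (1 : ℝ)) U * Z n U
          + ∑ S ∈ F, ∑ w ∈ S.biUnion (fun v => G.neighborFinset v), ∑ c ∈ Finset.range (n + 1),
              (A S w c).indicator (fun _ => (1 : ℝ)) U * (κ c * Φ⁻¹ * Y S w U)) ∂(labelMeasure V) :=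
        integral_mono (hintZ (n + 1)) (hintNZ.add (integrable_finsetSum _ fun S _ => integrable_finsetSum _ fun w _ =>
          integrable_finsetSum _ fun c _ => hintAY S w c)) hstep
    _ = ∫ U, N.indicator (fun _ => (1 : ℝ)) U * Z n U ∂(labelMeasure V)
          + ∑ S ∈ F, ∑ w ∈ S.biUnion (fun v => G.neighborFinset v), ∑ c ∈ Finset.range (n + 1),
              ∫ U, (A S w c).indicator (fun _ => (1 : ℝ)) U * (κ c * Φ⁻¹ * Y S w U) ∂(labelMeasure V) := by
        rw [integral_add hintNZ (integrable_finsetSum _ fun S _ => integrable_finsetSum _ fun w _ =>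
          integrable_finsetSum _ fun c _ => hintAY S w c)]
        rw [integral_finsetSum _ fun S _ => integrable_finsetSum _ fun w _ => integrable_finsetSum _ fun c _ => hintAY S w c]
        congr 1
        refine Finset.sum_congr rfl fun S _ => ?_
        rw [integral_finsetSum _ fun w _ => integrable_finsetSum _ fun c _ => hintAY S w c]
        refine Finset.sum_congr rfl fun w _ => ?_
        rw [integral_finsetSum _ fun c _ => hintAY S w c]
    _ ≤ ∫ U, N.indicator (fun _ => (1 : ℝ)) U * Z n U ∂(labelMeasure V)
          + ∑ S ∈ F, ∑ w ∈ S.biUnion (fun v => G.neighborFinset v), ∑ c ∈ Finset.range (n + 1),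
              ∫ U, (A S w c).indicator (fun _ => (1 : ℝ)) U * κ c ∂(labelMeasure V) := by
        exact add_le_add le_rfl (Finset.sum_le_sum fun S _ => Finset.sum_le_sum fun w _ =>
          Finset.sum_le_sum fun c _ => hpieceInt S w c)
    _ = ∫ U, (N.indicator (fun _ => (1 : ℝ)) U * Z n U
          + ∑ S ∈ F, ∑ w ∈ S.biUnion (fun v => G.neighborFinset v), ∑ c ∈ Finset.range (n + 1),
              (A S w c).indicator (fun _ => (1 : ℝ)) U * κ c) ∂(labelMeasure V) := by
        rw [integral_add hintNZ (integrable_finsetSum _ fun S _ => integrable_finsetSum _ fun w _ =>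
          integrable_finsetSum _ fun c _ => hintAκ S w c)]
        rw [integral_finsetSum _ fun S _ => integrable_finsetSum _ fun w _ => integrable_finsetSum _ fun c _ => hintAκ S w c]
        congr 1
        refine Finset.sum_congr rfl fun S _ => ?_
        rw [integral_finsetSum _ fun w _ => integrable_finsetSum _ fun c _ => hintAκ S w c]
        refine Finset.sum_congr rfl fun w _ => ?_
        rw [integral_finsetSum _ fun c _ => hintAκ S w c]
    _ = ∫ U, Z n U ∂(labelMeasure V) := integral_congr_ae (Eventually.of_forall fun U => (hsplit U).symm)

/-- **`E[Z_n] ≤ 1` for every `n`** (induction from `E[Z_0] = E[exp(t·T_L|C_y(o)|)]/Φ ≤ Φ_L/Φ ≤ 1`, the freshness step with `S = ∅`).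
[cite: ChayesChayesNewman1985, Lemma 3.4] -/
theorem integral_pondSupermartingale_le_one (hG : G.Preconnected) (o : V) (y : ℝ) {t : ℝ} (ht : 0 ≤ t) (L : ℕ) (q : ℕ → ℝ)
    (hq : ∀ (v : V) (m : ℕ), 1 ≤ m → m ≤ L →
      (labelMeasure V).real {U : Sym2 V → ℝ | (m : ℕ∞) ≤ (openCluster (configOfLabels y U G) v).encard} ≤ q m)
    {Φ : ℝ} (hΦ1 : 1 ≤ Φ) (hΦ : 1 + ∑ m ∈ Icc 1 L, (Real.exp (t * m) - Real.exp (t * (m - 1))) * q m ≤ Φ) (n : ℕ) :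
    ∫ U, Real.exp (t * ((min (⋃ v ∈ invasion G U o n, openCluster (configOfLabels y U G) v).encard (L : ℕ∞)).toNat : ℝ))
          * Φ⁻¹ ^ (badCount G U o y n + 1) ∂(labelMeasure V) ≤ 1 := by
  haveI : IsProbabilityMeasure (labelMeasure V) := isProbabilityMeasure_labelMeasure _
  have hΦ0 : 0 < Φ := lt_of_lt_of_le one_pos hΦ1
  induction n with
  | succ n ih => exact (integral_pondSupermartingale_succ_le hG o y ht L q hq hΦ1 hΦ n).trans ih
  | zero =>
    -- `Z_0 = exp(t T_L|C_y(o)|) Φ⁻¹`, and `C_y(o)` is the exterior cluster of `S = ∅`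
    have hempty : ∀ U : Sym2 V → ℝ, (⋃ v ∈ invasion G U o 0, openCluster (configOfLabels y U G) v)
        = openCluster (configOfLabels y U (G.deleteEdges {e | ∃ x ∈ (∅ : Finset V), x ∈ e})) o := by
      intro U
      rw [invasion_zero, Finset.set_biUnion_singleton]
      have : {e : Sym2 V | ∃ x ∈ (∅ : Finset V), x ∈ e} = ∅ := by ext e; simp
      rw [this, SimpleGraph.deleteEdges_empty]
    have hfresh := integral_indicator_mul_exp_exterior_le (G := G) y ht L q hq ∅ o MeasurableSet.univ
      (fun U U' _ => by simp)
    simp only [Set.indicator_univ, one_mul, probReal_univ] at hfresh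
    simp_rw [badCount_zero, zero_add, pow_one, hempty]
    rw [integral_mul_const]
    calc _ ≤ Φ * Φ⁻¹ := mul_le_mul_of_nonneg_right (hfresh.trans hΦ) (inv_nonneg.2 hΦ0.le)
      _ = 1 := mul_inv_cancel₀ hΦ0.ne'

/-! ## §4 The tail bound for the number of outlets -/

/-- **FEW OUTLETS ARE EXPONENTIALLY UNLIKELY**: on an infinite connected locally finite graph with countable vertex set, for every level `y`,
`t ≥ 0`, tail majorants `q_m ≥ μ{m ≤ |C_y(v)|}` (`1 ≤ m ≤ N + 1`, all `v`) and `Φ ≥ max(1, 1 + Σ_{m=1}^{N+1} (e^{tm} − e^{t(m−1)}) q_m)`: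
  `μ{M_N(y) ≤ k} ≤ Φ^{k+1} · exp(−t (N + 1))`.
(Markov on `Z_N` with `L = N + 1`: on the event, `|P_N| ≥ N + 1` gives `Z_N ≥ e^{t(N+1)} Φ^{−(k+1)}`, while `E[Z_N] ≤ 1`.)
[cite: ChayesChayesNewman1985, Lemma 3.4 and Thm 3.3 (C bounded away from 0)] -/
theorem labelMeasure_real_badCount_le_le (hG : G.Preconnected) (o : V) (y : ℝ) {t : ℝ} (ht : 0 ≤ t) (N : ℕ) (q : ℕ → ℝ)
    (hq : ∀ (v : V) (m : ℕ), 1 ≤ m → m ≤ N + 1 →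
      (labelMeasure V).real {U : Sym2 V → ℝ | (m : ℕ∞) ≤ (openCluster (configOfLabels y U G) v).encard} ≤ q m)
    {Φ : ℝ} (hΦ1 : 1 ≤ Φ) (hΦ : 1 + ∑ m ∈ Icc 1 (N + 1), (Real.exp (t * m) - Real.exp (t * (m - 1))) * q m ≤ Φ) (k : ℕ) :
    (labelMeasure V).real {U : Sym2 V → ℝ | badCount G U o y N ≤ k} ≤ Φ ^ (k + 1) * Real.exp (-(t * (N + 1))) := by
  haveI : IsProbabilityMeasure (labelMeasure V) := isProbabilityMeasure_labelMeasure _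
  have hΦ0 : 0 < Φ := lt_of_lt_of_le one_pos hΦ1
  have hΦi0 : 0 ≤ Φ⁻¹ := inv_nonneg.2 hΦ0.le
  have hΦi1 : Φ⁻¹ ≤ 1 := inv_le_one_of_one_le₀ hΦ1
  set Z : (Sym2 V → ℝ) → ℝ := fun U =>
    Real.exp (t * ((min (⋃ v ∈ invasion G U o N, openCluster (configOfLabels y U G) v).encard ((N + 1 : ℕ) : ℕ∞)).toNat : ℝ))
      * Φ⁻¹ ^ (badCount G U o y N + 1) with hZ
  have hZ0 : ∀ U, 0 ≤ Z U := fun U => mul_nonneg (Real.exp_nonneg _) (pow_nonneg hΦi0 _)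
  have hZm : Measurable Z :=
    ((measurable_truncVol (fun m => measurableSet_le_encard_pondClosure (G := G) o y N m) (N + 1)).const_mul t).exp.mul
      ((measurable_from_nat (f := fun c : ℕ => Φ⁻¹ ^ (c + 1))).comp (measurable_badCount o y N))
  have hZint : Integrable Z (labelMeasure V) := by
    refine (memLp_top_of_bound hZm.aestronglyMeasurable (Real.exp (t * ((N + 1 : ℕ) : ℝ)))
      (Eventually.of_forall fun U => ?_)).integrable le_top
    rw [Real.norm_eq_abs, abs_of_nonneg (hZ0 U)]
    calc Z U ≤ Real.exp (t * ((N + 1 : ℕ) : ℝ)) * 1 :=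
          mul_le_mul (exp_mul_truncVol_le ht (N + 1) _) (pow_le_one₀ hΦi0 hΦi1) (pow_nonneg hΦi0 _) (Real.exp_nonneg _)
      _ = _ := mul_one _
  have hEZ : ∫ U, Z U ∂(labelMeasure V) ≤ 1 := integral_pondSupermartingale_le_one hG o y ht (N + 1) q hq hΦ1 hΦ N
  -- on the event, `Z ≥ ε := exp(t(N+1)) Φ⁻¹^(k+1)`
  set ε : ℝ := Real.exp (t * (N + 1)) * Φ⁻¹ ^ (k + 1) with hε
  have hε0 : 0 < ε := mul_pos (Real.exp_pos _) (pow_pos (inv_pos.2 hΦ0) _)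
  have hsub : {U : Sym2 V → ℝ | badCount G U o y N ≤ k} ⊆ {U | ε ≤ Z U} := by
    intro U hU
    rw [Set.mem_setOf_eq] at hU
    have hvol : (min (⋃ v ∈ invasion G U o N, openCluster (configOfLabels y U G) v).encard ((N + 1 : ℕ) : ℕ∞)).toNat = N + 1 :=
      toNat_min_eq_of_le _ (succ_le_encard_pondClosure hG U o y N)
    have hpow : Φ⁻¹ ^ (k + 1) ≤ Φ⁻¹ ^ (badCount G U o y N + 1) :=
      pow_le_pow_of_le_one hΦi0 hΦi1 (by omega)
    show ε ≤ Z U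
    simp only [hZ, hε, hvol]
    push_cast
    exact mul_le_mul_of_nonneg_left hpow (Real.exp_nonneg _)
  have hmarkov := mul_meas_ge_le_integral_of_nonneg (Eventually.of_forall hZ0) hZint ε
  have h1 : ε * (labelMeasure V).real {U : Sym2 V → ℝ | badCount G U o y N ≤ k} ≤ 1 :=
    le_trans (le_trans (mul_le_mul_of_nonneg_left (measureReal_mono hsub (measure_ne_top _ _)) hε0.le) hmarkov) hEZ
  rw [← le_div_iff₀' hε0] at h1
  refine h1.trans (le_of_eq ?_)
  rw [hε, one_div, mul_inv, ← Real.exp_neg, inv_pow, inv_inv, mul_comm]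

end General

end Summit.CriticalPhenomena.PercolationContinuityZ3.Theorems.Rsw3

end
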